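import Mathlib
import Summits.NavierStokesRegularity.NavierStokesRegularity.Theorems.LandauTailLandauTailBlowupCoreRadiusEnergy
import Summits.NavierStokesRegularity.NavierStokesRegularity.Theorems.LandauTailLandauTailBlowupGradientDyadic

/-!
# Crux `LandauTail.LandauTailBlowup` (stmt-NavierStokesRegularity-1944), line `registered`, cycle c7:
  stub `landauTail_cknA_tendsto_top_of_tame` — TAME flows are Type II in Seregin's scaled energy `A`

Helper file on the proof path of the crux item `stmt-NavierStokesRegularity-1944`
(`Summit.NavierStokesRegularity.NavierStokesRegularity.Theses.LandauTail.LandauTailBlowup`), lead c7: the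
registered support stub `landauTail_cknA_tendsto_top_of_tame` (L6), composed from the shell theorem, energy form
(`landauTail_shell_energy_floor`, p173525).

THEOREM. Let `(U, P)` be a nonzero steady `(−1)`-homogeneous profile smooth off the origin and `u` a classical
unit-viscosity flow on `ℝ³ × (−1, 0)` whose parabolic rescalings `u_λ` become `L²`-close to the Landau flow `U` on
EVERY shell `ρ/2 < |y| < ρ`, `0 < ρ ≤ 1`, over one window `(s₁, s₂)` as `λ → 0⁺` ("tame": the defect is confined
to the core — what every matched-asymptotics construction of a Landau-tailed singularity delivers, and what holds
under locally uniform convergence off the time axis). Then Seregin's scaled energy diverges: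
`A(r) = sup_{−r²<t<0} r⁻¹ ∫_{B_r} |u(t)|² → ∞` as `r → 0⁺`, with the rate `A(λ) ≥ c (s₂ − s₁)² ρ⁻³` for every
tame radius `ρ` — Type II in the last of Seregin's three scaled energies (c5/c6 gave `C(r), E(r) → ∞` for every
witness; `A` needs tameness or suitability, cf. `landauTail_limsup_cknA_eq_top_of_suitable`).

PROOF. Fix `M`; choose `ρ` with `c (s₂−s₁)² ρ⁻³ > M`; for small `λ` the shell of radius `ρ` is close, so the shell
theorem gives `t ∈ [s₁, s₂]` with `∫_{B_ρ}|u_λ(t)|² ≥ c(s₂−s₁)²ρ⁻³`, and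
`A(λ) ≥ λ⁻¹∫_{B_λ}|u(λ²t)|² ≥ λ⁻¹∫_{B_{λρ}}|u(λ²t)|² = ∫_{B_ρ}|u_λ(t)|²`.
-/

set_option linter.dupNamespace false

noncomputable section

open Filter Set Topology MeasureTheory Metric Function
open scoped ENNReal NNReal InnerProductSpace RealInnerProductSpace Laplacian ContDiff
open Literature.Analysis.FluidPDE

namespace Summit.NavierStokesRegularity.NavierStokesRegularity.Theorems

/-- The rescaled slice energy: `∫_{B_R} |u_λ(s)|² = λ⁻¹ ∫_{B_{λR}} |u(λ²s)|²` (`x = λy`, Jacobian `λ³`, prefactor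
`λ²`). [folklore] -/
theorem landauTail_tameA_rescaled_slice_energy (u : ℝ → EuclideanSpace ℝ (Fin 3) → EuclideanSpace ℝ (Fin 3))
    {lam : ℝ} (hlam : 0 < lam) (R s : ℝ) :
    ∫⁻ x in ball (0 : EuclideanSpace ℝ (Fin 3)) R, ‖nsRescale lam u s x‖ₑ ^ 2 =
      ENNReal.ofReal lam⁻¹ * ∫⁻ y in ball (0 : EuclideanSpace ℝ (Fin 3)) (lam * R), ‖u (lam ^ 2 * s) y‖ₑ ^ 2 := by
  have hpt : ∀ x : EuclideanSpace ℝ (Fin 3),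
      ‖nsRescale lam u s x‖ₑ ^ 2 = ENNReal.ofReal (lam ^ 2) * ‖u (lam ^ 2 * s) (lam • x)‖ₑ ^ 2 := by
    intro x
    rw [nsRescale_apply, enorm_smul, mul_pow, Real.enorm_eq_ofReal hlam.le, ENNReal.ofReal_pow hlam.le]
  have hball : ∫⁻ y in ball (0 : EuclideanSpace ℝ (Fin 3)) (lam * R), ‖u (lam ^ 2 * s) y‖ₑ ^ 2 =
      ENNReal.ofReal (lam ^ 3) * ∫⁻ x in ball (0 : EuclideanSpace ℝ (Fin 3)) R, ‖u (lam ^ 2 * s) (lam • x)‖ₑ ^ 2 := by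
    have h := landauTail_gradDyadic_setLIntegral_ball_smul (fun y => ‖u (lam ^ 2 * s) y‖ₑ ^ 2) hlam 0 R
    rwa [smul_zero] at h
  calc ∫⁻ x in ball (0 : EuclideanSpace ℝ (Fin 3)) R, ‖nsRescale lam u s x‖ₑ ^ 2
      = ∫⁻ x in ball (0 : EuclideanSpace ℝ (Fin 3)) R,
          ENNReal.ofReal (lam ^ 2) * ‖u (lam ^ 2 * s) (lam • x)‖ₑ ^ 2 := lintegral_congr fun x => hpt x
    _ = ENNReal.ofReal (lam ^ 2) *
          ∫⁻ x in ball (0 : EuclideanSpace ℝ (Fin 3)) R, ‖u (lam ^ 2 * s) (lam • x)‖ₑ ^ 2 :=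
        lintegral_const_mul' _ _ ENNReal.ofReal_ne_top
    _ = ENNReal.ofReal lam⁻¹ * (ENNReal.ofReal (lam ^ 3) *
          ∫⁻ x in ball (0 : EuclideanSpace ℝ (Fin 3)) R, ‖u (lam ^ 2 * s) (lam • x)‖ₑ ^ 2) := by
        rw [← mul_assoc, ← ENNReal.ofReal_mul (inv_nonneg.2 hlam.le)]
        congr 2
        field_simp
    _ = _ := by rw [hball]

/-- A slice of the scaled energy bounds `A` from below: for `t ∈ (−1, 0)`, `ρ ≤ 1`, `λ > 0`,
`∫_{B_ρ}|u_λ(t)|² ≤ A(λ) = sup_{−λ²<τ<0} λ⁻¹∫_{B_λ}|u(τ)|²`. [folklore] -/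
theorem landauTail_tameA_slice_le_cknA (u : ℝ → EuclideanSpace ℝ (Fin 3) → EuclideanSpace ℝ (Fin 3))
    {lam ρ t : ℝ} (hlam : 0 < lam) (hρ1 : ρ ≤ 1) (ht : t ∈ Ioo (-1 : ℝ) 0) :
    ∫⁻ x in ball (0 : EuclideanSpace ℝ (Fin 3)) ρ, ‖nsRescale lam u t x‖ₑ ^ 2 ≤
      cknA lam ((0 : ℝ), (0 : EuclideanSpace ℝ (Fin 3))) u := by
  rw [landauTail_tameA_rescaled_slice_energy u hlam ρ t]
  have hτ : lam ^ 2 * t ∈ Ioo ((0 : ℝ) - lam ^ 2) 0 := by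
    have hl2 : 0 < lam ^ 2 := pow_pos hlam 2
    refine ⟨by nlinarith [ht.1], mul_neg_of_pos_of_neg hl2 ht.2⟩
  have hsub : ball (0 : EuclideanSpace ℝ (Fin 3)) (lam * ρ) ⊆ ball 0 lam :=
    ball_subset_ball (by nlinarith)
  calc ENNReal.ofReal lam⁻¹ * ∫⁻ y in ball (0 : EuclideanSpace ℝ (Fin 3)) (lam * ρ), ‖u (lam ^ 2 * t) y‖ₑ ^ 2
      ≤ (ENNReal.ofReal lam)⁻¹ * ∫⁻ y in ball (0 : EuclideanSpace ℝ (Fin 3)) lam, ‖u (lam ^ 2 * t) y‖ₑ ^ 2 := by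
        rw [ENNReal.ofReal_inv_of_pos hlam]
        exact mul_le_mul_right (lintegral_mono_set hsub) _
    _ ≤ cknA lam ((0 : ℝ), (0 : EuclideanSpace ℝ (Fin 3))) u := by
        unfold cknA
        exact le_iSup₂ (f := fun τ (_ : τ ∈ Ioo ((0 : ℝ) - lam ^ 2) 0) =>
          (ENNReal.ofReal lam)⁻¹ * ∫⁻ x in ball (0 : EuclideanSpace ℝ (Fin 3)) lam, ‖u τ x‖ₑ ^ 2) (lam ^ 2 * t) hτ

/-- **L6 — TAME flows are Type II in Seregin's scaled energy `A`** (registered support stub of crux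
stmt-NavierStokesRegularity-1944, lead c7): if the rescalings of a classical flow become `L²`-close to the Landau
flow on EVERY shell (for one window) then `A(r) → ∞` as `r → 0⁺`. [folklore] -/
theorem landauTail_cknA_tendsto_top_of_tame : ∀ (U : EuclideanSpace ℝ (Fin 3) → EuclideanSpace ℝ (Fin 3)) (P : EuclideanSpace ℝ (Fin 3) → ℝ), (ContDiffOn ℝ (⊤ : ℕ∞) U {0}ᶜ ∧ ContDiffOn ℝ (⊤ : ℕ∞) P {0}ᶜ ∧ (∀ x : EuclideanSpace ℝ (Fin 3), x ≠ 0 → Literature.Analysis.FluidPDE.convect U U x + gradient P x = (1 : ℝ) • Laplacian.laplacian U x) ∧ (∀ x : EuclideanSpace ℝ (Fin 3), x ≠ 0 → Literature.Analysis.FluidPDE.VectorCalculus.divergence U x = 0) ∧ (∀ c : ℝ, 0 < c → ∀ x : EuclideanSpace ℝ (Fin 3), U (c • x) = c⁻¹ • U x) ∧ (∃ x : EuclideanSpace ℝ (Fin 3), U x ≠ 0)) → ∀ (u : ℝ → EuclideanSpace ℝ (Fin 3) → EuclideanSpace ℝ (Fin 3)) (p : ℝ → EuclideanSpace ℝ (Fin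 3) → ℝ), Literature.Analysis.FluidPDE.IsClassicalNSSolutionOn (Set.Ioo (-1) 0) 1 0 u p → ∀ s₁ s₂ : ℝ, -1 < s₁ → s₁ < s₂ → s₂ < 0 → (∀ ρ : ℝ, 0 < ρ → ρ ≤ 1 → Filter.Tendsto (fun lam : ℝ => ∫⁻ z in Set.Ioo s₁ s₂ ×ˢ (Metric.ball (0 : EuclideanSpace ℝ (Fin 3)) ρ \ Metric.closedBall (0 : EuclideanSpace ℝ (Fin 3)) (ρ / 2)), ‖Literature.Analysis.FluidPDE.nsRescale lam u z.1 z.2 - U z.2‖ₑ ^ 2) (nhdsWithin 0 (Set.Ioi 0)) (nhds 0)) → Filter.Tendsto (fun r : ℝ => Literature.Analysis.FluidPDE.cknA r ((0 : ℝ), (0 : EuclideanSpace ℝ (Fin 3))) u) (nhdsWithin 0 (Set.Ioi 0)) (nhds ⊤) := by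
  intro U P hprof u p hcl s₁ s₂ hs₁ hs₁₂ hs₂ htame
  obtain ⟨c, hc, ε, hε, hshell⟩ := landauTail_shell_energy_floor U P hprof
  set Δs : ℝ := s₂ - s₁ with hΔs_def
  have hΔs : 0 < Δs := by rw [hΔs_def]; linarith
  rw [ENNReal.tendsto_nhds_top_iff_nnreal]
  intro M
  -- a shell radius with `c Δs² / ρ³ > M`
  set x : ℝ := c * Δs ^ 2 / ((M : ℝ) + 1) with hx_def
  have hx : 0 < x := by positivity
  set ρ : ℝ := min 1 x with hρ_def
  have hρ : 0 < ρ := lt_min one_pos hx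
  have hρ1 : ρ ≤ 1 := min_le_left _ _
  have hρM : (M : ℝ) < c * Δs ^ 2 / ρ ^ 3 := by
    rw [lt_div_iff₀ (by positivity)]
    rcases le_or_gt 1 x with h1 | h1
    · have hρeq : ρ = 1 := min_eq_left h1
      rw [hρeq, one_pow, mul_one]
      have : (M : ℝ) + 1 ≤ c * Δs ^ 2 := by rwa [hx_def, le_div_iff₀ (by positivity), one_mul] at h1
      linarith
    · have hρeq : ρ = x := min_eq_right h1.le
      rw [hρeq]
      have hx3 : x ^ 3 < x := by
        have hx2 : x ^ 2 < 1 := pow_lt_one₀ hx.le h1 two_ne_zero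
        calc x ^ 3 = x * x ^ 2 := by ring
          _ < x * 1 := mul_lt_mul_of_pos_left hx2 hx
          _ = x := mul_one x
      have hM0 : (0 : ℝ) ≤ M := M.2
      calc (M : ℝ) * x ^ 3 ≤ (M + 1) * x ^ 3 := by nlinarith [pow_pos hx 3]
        _ < (M + 1) * x := by nlinarith
        _ = c * Δs ^ 2 := by rw [hx_def]; field_simp
  -- eventually the shell of radius `ρ` is close and `λ ≤ 1`
  have h1 : ∀ᶠ lam in 𝓝[>] (0 : ℝ), ∫⁻ z in Ioo s₁ s₂ ×ˢ (ball (0 : EuclideanSpace ℝ (Fin 3)) ρ \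
      closedBall (0 : EuclideanSpace ℝ (Fin 3)) (ρ / 2)), ‖nsRescale lam u z.1 z.2 - U z.2‖ₑ ^ 2 ≤
      ENNReal.ofReal (ε * ρ * (s₂ - s₁)) := by
    have hpos : (0 : ℝ≥0∞) < ENNReal.ofReal (ε * ρ * (s₂ - s₁)) := by
      rw [ENNReal.ofReal_pos]; rw [hΔs_def] at hΔs; positivity
    exact ((htame ρ hρ hρ1).eventually (gt_mem_nhds hpos)).mono fun lam h => h.le
  have h2 : ∀ᶠ lam in 𝓝[>] (0 : ℝ), lam ∈ Ioc (0 : ℝ) 1 := Ioc_mem_nhdsGT zero_lt_one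
  filter_upwards [h1, h2] with lam hclose hlam
  have hv := landauTail_coreRadius_nsRescale_classical hcl hlam.1 hlam.2
  obtain ⟨t, ht, hE⟩ := hshell (nsRescale lam u) (nsRescalePressure lam p) hv ρ hρ hρ1 s₁ s₂ hs₁ hs₁₂ hs₂ hclose
  have ht' : t ∈ Ioo (-1 : ℝ) 0 := ⟨hs₁.trans_le ht.1, ht.2.trans_lt hs₂⟩
  calc (M : ℝ≥0∞) = ENNReal.ofReal (M : ℝ) := (ENNReal.ofReal_coe_nnreal).symm
    _ < ENNReal.ofReal (c * (s₂ - s₁) ^ 2 / ρ ^ 3) := (ENNReal.ofReal_lt_ofReal_iff (by positivity)).2 hρM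
    _ ≤ ∫⁻ x in ball (0 : EuclideanSpace ℝ (Fin 3)) ρ, ‖nsRescale lam u t x‖ₑ ^ 2 := hE
    _ ≤ cknA lam ((0 : ℝ), (0 : EuclideanSpace ℝ (Fin 3))) u := landauTail_tameA_slice_le_cknA u hlam.1 hρ1 ht'

end Summit.NavierStokesRegularity.NavierStokesRegularity.Theorems

end
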